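import Summits.KontsevichZagierPeriods.KontsevichZagierPeriods.Theorems.HermiteRigidityReductionRigidityLineReduction
import Literature.NumberTheory.Transcendental.KZRulesAssociator

/-!
# KontsevichZagierPeriods / HermiteRigidity — crux `ReductionRigidity` (stmt-KontsevichZagierPeriods-3407), line `Sketch` (Landen join island): the PRODUCT-SECTOR reduction

Route `KontsevichZagierPeriods/HermiteRigidity`, crux stmt-KontsevichZagierPeriods-3407 (`ReductionRigidity`),
crux-chain line `Sketch`, cycle-2 growth (the LANDEN JOIN island: levels `q` and `1 − q` together with the
product sector). Registered stub `stub_joinProductReduction`: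

for every integer `q ≥ 2`, every PRODUCT generator on the closed unit square
`[□², x^a y^b/((q − x)^m (q − y)^n)]` reduces modulo `KZ.relations` to the three normal forms with
RATIONAL coefficients

  `[pt, α] + [□¹, β/(q − x)] + [□², ε/((q − x)(q − y))]`   (`α, β, ε ∈ ℚ`;
  values `α + β·L₁ + ε·L₁²`, `L₁ = log(q/(q − 1))`).

Mechanism: the product generator IS the Fubini product `[□¹, x^a/(q − x)^m] · [□¹, y^b/(q − y)^n]` of two
line generators (`KZ.RFun.rel_tensor`, Kontsevich–Zagier's "the product of integrals is again an
integral"); each factor reduces by the landed LINE reduction (`lineReduction`: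
`[□¹, x^c/(q − x)^m] ≡ [□¹, β/(q − x)] + [pt, γ]`); since `KZ.relations` is a two-sided ideal the two
congruences multiply, and the computation is carried out in the commutative formal period ring
`KZ.FormalPeriodRing = FormalRep ⧸ relations` (`KZ.toFormalPeriod`), where the four products of normal
forms are again normal forms (`[□¹, β/(q−x)]·[□¹, β'/(q−x)] ≡ [□², ββ'/((q−x)(q−y))]`,
`[□¹, β/(q−x)]·[pt, γ] ≡ [□¹, βγ/(q−x)]`, `[pt, γ]·[pt, γ'] ≡ [pt, γγ']`) and the two weight-one terms
merge by integrand additivity.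

All carriers are tame cube representations of regular rational functions (`KZ.RFun`); no variable is
integrated out. No definitions are introduced.

References: M. Kontsevich, D. Zagier, *Periods* (2001), §1.2 rules (1)–(3), §4.1 (Fubini)
[cite: KontsevichZagier2001, §4.1]; J. Ayoub, EMS Newsl. 91 (2014), Def. 10 [cite: Ayoub2014, Def. 10].
-/

noncomputable section

open MeasureTheory Set MvPolynomial

namespace Summit.KontsevichZagierPeriods.HermiteRigidity.ReductionRigidity

open Literature.NumberTheory.Transcendental
open Literature.NumberTheory.Transcendental.KZ

/-! ## Toolkit: the carriers of the product sector as regular rational functions -/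

/-- The line generator `x^a/(N − x)^m` is a regular rational function on the closed interval (`N ≥ 2`).
[cite: KontsevichZagier2001, §1.1] -/
theorem joinProd_exists_lineRFun {N : ℕ} (hN : 2 ≤ N) (a m : ℕ) :
    ∃ T : RFun 1, ∀ x, T.fn x = x 0 ^ a / ((N : ℝ) - x 0) ^ m :=
  ⟨⟨X 0 ^ a, (C (N : ℚ) - X 0) ^ m, lineBase_den_ne hN m⟩, fun x => by
    simp only [RFun.fn, map_pow, map_sub, aeval_C, aeval_X, eq_ratCast, Rat.cast_natCast]⟩

/-- The line normal form `β/(N − x)` is a regular rational function on the closed interval (`N ≥ 2`).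
[cite: KontsevichZagier2001, §1.1] -/
theorem joinProd_exists_nf1RFun {N : ℕ} (hN : 2 ≤ N) (β : ℚ) :
    ∃ T : RFun 1, ∀ x, T.fn x = (β : ℝ) / ((N : ℝ) - x 0) :=
  ⟨⟨C β, (C (N : ℚ) - X 0) ^ 1, lineBase_den_ne hN 1⟩, fun x => by
    simp only [RFun.fn, pow_one, map_sub, aeval_C, aeval_X, eq_ratCast, Rat.cast_natCast]⟩

/-- The product normal form `ε/((N − x)(N − y))` is a regular rational function on the closed square
(`N ≥ 2`). [cite: KontsevichZagier2001, §1.1] -/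
theorem joinProd_exists_nf2RFun {N : ℕ} (hN : 2 ≤ N) (ε : ℚ) :
    ∃ T : RFun 2, ∀ x, T.fn x = (ε : ℝ) / (((N : ℝ) - x 0) * ((N : ℝ) - x 1)) := by
  refine ⟨⟨C ε, (C (N : ℚ) - X 0) * (C (N : ℚ) - X 1), fun x hx => ?_⟩, fun x => ?_⟩
  · have h2 : (2 : ℝ) ≤ (N : ℝ) := by exact_mod_cast hN
    have h0 := (hx 0).2
    have h1 := (hx 1).2
    simp only [map_mul, map_sub, aeval_C, aeval_X, eq_ratCast, Rat.cast_natCast]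
    exact mul_ne_zero (ne_of_gt (by linarith)) (ne_of_gt (by linarith))
  · simp only [RFun.fn, map_mul, map_sub, aeval_C, aeval_X, eq_ratCast, Rat.cast_natCast]

/-- The first coordinate of `□² = □¹ × □¹`. [folklore] -/
theorem joinProd_castAdd_zero : (Fin.castAdd 1 (0 : Fin 1) : Fin 2) = 0 := rfl

/-- The second coordinate of `□² = □¹ × □¹`. [folklore] -/
theorem joinProd_natAdd_zero : (Fin.natAdd 1 (0 : Fin 1) : Fin 2) = 1 := rfl

/-- The coordinate of `□¹ = □¹ × pt`. [folklore] -/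
theorem joinProd_castAdd_zero' : (Fin.castAdd 0 (0 : Fin 1) : Fin 1) = 0 := rfl

/-! ## Toolkit: computing in the formal period ring `FormalRep ⧸ relations` -/

/-- A representation on the closed cube carrying the values of a regular rational function `T` has the
formal period of `[□, T]` (integrand congruence). [cite: KontsevichZagier2001, §1.2 rule (1)] -/
theorem joinProd_bridge {n : ℕ} {r : IntegralRep n} {f : (Fin n → ℝ) → ℝ} (hrd : r.domain = cube n)
    (hri : EqOn r.integrand f (cube n)) (T : RFun n) (hT : ∀ x ∈ cube n, T.fn x = f x) :
    toFormalPeriod (KZ.of r) = toFormalPeriod (KZ.of T.rep) :=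
  toFormalPeriod_eq_iff.mpr (lineBase_bridge hrd hri T hT)

/-- A reduction `x ≡ y + z` read in the formal period ring. [cite: KontsevichZagier2001, §1.2] -/
theorem joinProd_split {x y z : FormalRep} (h : x - (y + z) ∈ KZ.relations) :
    toFormalPeriod x = toFormalPeriod y + toFormalPeriod z := by
  rw [← map_add]
  exact toFormalPeriod_eq_iff.mpr h

/-- **Fubini in the formal period ring**: `⟦[□ᴹ, T]⟧ · ⟦[□ᴺ, S]⟧ = ⟦[□ᴹ⁺ᴺ, U]⟧` whenever
`U = T ⊗ S` on the cube (`KZ.RFun.rel_tensor`, then integrand congruence).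
[cite: KontsevichZagier2001, §4.1] -/
theorem joinProd_tensor {M N : ℕ} (T : RFun M) (S : RFun N) (U : RFun (M + N))
    (h : ∀ z ∈ cube (M + N),
      T.fn (fun i => z (Fin.castAdd N i)) * S.fn (fun j => z (Fin.natAdd M j)) = U.fn z) :
    toFormalPeriod (KZ.of T.rep) * toFormalPeriod (KZ.of S.rep) = toFormalPeriod (KZ.of U.rep) := by
  rw [← map_mul, toFormalPeriod_eq_iff]
  have h1 := RFun.rel_tensor T S
  have h2 : KZ.of (T.tensor S).rep - KZ.of U.rep ∈ KZ.relations :=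
    RFun.rel_of_eqOn fun z hz => by rw [RFun.fn_tensor]; exact h z hz
  have h12 := KZ.relations.add_mem h1 h2
  rwa [sub_add_sub_cancel] at h12

/-- `[□¹, β/(N−x)] · [□¹, β'/(N−x)] = [□², ββ'/((N−x)(N−y))]` in the formal period ring.
[cite: KontsevichZagier2001, §4.1] -/
theorem joinProd_nf1_mul_nf1 {N : ℕ} {β β' : ℚ} (T S : RFun 1) (U : RFun 2)
    (hT : ∀ x, T.fn x = (β : ℝ) / ((N : ℝ) - x 0)) (hS : ∀ x, S.fn x = (β' : ℝ) / ((N : ℝ) - x 0))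
    (hU : ∀ x, U.fn x = ((β * β' : ℚ) : ℝ) / (((N : ℝ) - x 0) * ((N : ℝ) - x 1))) :
    toFormalPeriod (KZ.of T.rep) * toFormalPeriod (KZ.of S.rep) = toFormalPeriod (KZ.of U.rep) := by
  have key : ∀ z : Fin 2 → ℝ,
      T.fn (fun i => z (Fin.castAdd 1 i)) * S.fn (fun j => z (Fin.natAdd 1 j)) = U.fn z := by
    intro z
    rw [hT, hS, hU]
    simp only [joinProd_castAdd_zero, joinProd_natAdd_zero]
    rw [div_mul_div_comm, Rat.cast_mul]
  exact joinProd_tensor T S U fun z _ => key z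

/-- `[□¹, β/(N−x)] · [pt, γ] = [□¹, βγ/(N−x)]` in the formal period ring.
[cite: KontsevichZagier2001, §4.1] -/
theorem joinProd_nf1_mul_nf0 {N : ℕ} {β γ : ℚ} (T : RFun 1) (S : RFun 0) (U : RFun 1)
    (hT : ∀ x, T.fn x = (β : ℝ) / ((N : ℝ) - x 0)) (hS : ∀ x, S.fn x = (γ : ℝ))
    (hU : ∀ x, U.fn x = ((β * γ : ℚ) : ℝ) / ((N : ℝ) - x 0)) :
    toFormalPeriod (KZ.of T.rep) * toFormalPeriod (KZ.of S.rep) = toFormalPeriod (KZ.of U.rep) := by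
  have key : ∀ z : Fin 1 → ℝ,
      T.fn (fun i => z (Fin.castAdd 0 i)) * S.fn (fun j => z (Fin.natAdd 1 j)) = U.fn z := by
    intro z
    rw [hT, hS, hU]
    simp only [joinProd_castAdd_zero']
    push_cast
    ring
  exact joinProd_tensor T S U fun z _ => key z

/-- `[pt, γ] · [pt, γ'] = [pt, γγ']` in the formal period ring. [cite: KontsevichZagier2001, §4.1] -/
theorem joinProd_nf0_mul_nf0 {γ γ' : ℚ} (T S U : RFun 0)
    (hT : ∀ x, T.fn x = (γ : ℝ)) (hS : ∀ x, S.fn x = (γ' : ℝ)) (hU : ∀ x, U.fn x = ((γ * γ' : ℚ) : ℝ)) :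
    toFormalPeriod (KZ.of T.rep) * toFormalPeriod (KZ.of S.rep) = toFormalPeriod (KZ.of U.rep) := by
  have key : ∀ z : Fin 0 → ℝ,
      T.fn (fun i => z (Fin.castAdd 0 i)) * S.fn (fun j => z (Fin.natAdd 0 j)) = U.fn z := by
    intro z
    rw [hT, hS, hU]
    push_cast
    ring
  exact joinProd_tensor T S U fun z _ => key z

/-- Merging two weight-one normal forms: `[□¹, (β+β')/(N−x)] = [□¹, β/(N−x)] + [□¹, β'/(N−x)]` in the
formal period ring (integrand additivity). [cite: KontsevichZagier2001, §1.2 rule (1)] -/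
theorem joinProd_nf1_add {N : ℕ} {β β' : ℚ} (T S U : RFun 1)
    (hT : ∀ x, T.fn x = (β : ℝ) / ((N : ℝ) - x 0)) (hS : ∀ x, S.fn x = (β' : ℝ) / ((N : ℝ) - x 0))
    (hU : ∀ x, U.fn x = ((β + β' : ℚ) : ℝ) / ((N : ℝ) - x 0)) :
    toFormalPeriod (KZ.of U.rep) = toFormalPeriod (KZ.of T.rep) + toFormalPeriod (KZ.of S.rep) := by
  have h1 := RFun.rel_add T S
  have h2 : KZ.of U.rep - KZ.of (T.add S).rep ∈ KZ.relations :=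
    RFun.rel_of_eqOn fun x hx => by rw [RFun.fn_add hx, hT, hS, hU]; push_cast; ring
  rw [← map_add, toFormalPeriod_eq_iff]
  have h12 := KZ.relations.add_mem h1 h2
  have : KZ.of (T.add S).rep - KZ.of T.rep - KZ.of S.rep + (KZ.of U.rep - KZ.of (T.add S).rep) =
      KZ.of U.rep - (KZ.of T.rep + KZ.of S.rep) := by abel
  rwa [this] at h12

/-! ## The product-sector reduction -/

/-- **Stub `stub_joinProductReduction`** (crux `ReductionRigidity`, stmt-3407, line `Sketch`, Landen join
island): every product generator `[□², x^a y^b/((q − x)^m (q − y)^n)]` (`q ≥ 2`) reduces modulo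
`KZ.relations` to `[pt, α] + [□¹, β/(q − x)] + [□², ε/((q − x)(q − y))]` with `α, β, ε ∈ ℚ`: the
generator is the Fubini product of two line generators, each reduced by `lineReduction`, and the product
of the two reductions is expanded in the formal period ring. [cite: KontsevichZagier2001, §1.2, §4.1] -/
theorem stub_joinProductReduction : ∀ (q : ℕ), 2 ≤ q → ∀ (a b m n : ℕ) (r : IntegralRep 2),
    r.domain = cube 2 →
    EqOn r.integrand (fun p => p 0 ^ a * p 1 ^ b / (((q : ℝ) - p 0) ^ m * ((q : ℝ) - p 1) ^ n)) (cube 2) →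
    ∃ (α β ε : ℚ) (s₀ : IntegralRep 0) (s₁ : IntegralRep 1) (s₂ : IntegralRep 2),
      s₀.domain = cube 0 ∧ EqOn s₀.integrand (fun _ => (α : ℝ)) (cube 0) ∧
      s₁.domain = cube 1 ∧ EqOn s₁.integrand (fun p => (β : ℝ) / ((q : ℝ) - p 0)) (cube 1) ∧
      s₂.domain = cube 2 ∧ EqOn s₂.integrand (fun p => (ε : ℝ) / (((q : ℝ) - p 0) * ((q : ℝ) - p 1))) (cube 2) ∧
      KZ.of r - (KZ.of s₀ + KZ.of s₁ + KZ.of s₂) ∈ KZ.relations := by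
  intro q hq a b m n r hr hri
  -- the two line factors and their line reductions
  obtain ⟨F, hF⟩ := joinProd_exists_lineRFun hq a m
  obtain ⟨G, hG⟩ := joinProd_exists_lineRFun hq b n
  obtain ⟨βf, γf, s₁f, s₀f, hs₁f, hs₁fi, hs₀f, hs₀fi, hf⟩ := lineReduction hq a 1 m F.rep rfl
    fun x _ => by simp only [RFun.rep_integrand, hF, Rat.cast_one, one_mul]
  obtain ⟨βg, γg, s₁g, s₀g, hs₁g, hs₁gi, hs₀g, hs₀gi, hg⟩ := lineReduction hq b 1 n G.rep rfl
    fun x _ => by simp only [RFun.rep_integrand, hG, Rat.cast_one, one_mul]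
  -- the normal-form carriers as regular rational functions
  obtain ⟨B₁, hB₁⟩ := joinProd_exists_nf1RFun hq βf
  obtain ⟨B₂, hB₂⟩ := joinProd_exists_nf1RFun hq βg
  obtain ⟨E, hE⟩ := joinProd_exists_nf2RFun hq (βf * βg)
  obtain ⟨B₁₂, hB₁₂⟩ := joinProd_exists_nf1RFun hq (βf * γg)
  obtain ⟨B₂₁, hB₂₁⟩ := joinProd_exists_nf1RFun hq (βg * γf)
  obtain ⟨B, hB⟩ := joinProd_exists_nf1RFun hq (βf * γg + βg * γf)
  refine ⟨γf * γg, βf * γg + βg * γf, βf * βg, (RFun.const (γf * γg) : RFun 0).rep, B.rep, E.rep,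
    rfl, fun x _ => ?_, rfl, fun x _ => ?_, rfl, fun x _ => ?_, ?_⟩
  · simp only [RFun.rep_integrand, RFun.fn_const, Rat.cast_mul]
  · rw [RFun.rep_integrand, hB]
  · rw [RFun.rep_integrand, hE]
  -- the computation in the formal period ring
  rw [← toFormalPeriod_eq_iff, map_add, map_add]
  have eR : toFormalPeriod (KZ.of r) = toFormalPeriod (KZ.of (F.tensor G).rep) := by
    refine joinProd_bridge hr hri (F.tensor G) fun x _ => ?_
    rw [RFun.fn_tensor, hF, hG]
    simp only [joinProd_castAdd_zero, joinProd_natAdd_zero]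
    rw [div_mul_div_comm]
  have eT : toFormalPeriod (KZ.of F.rep) * toFormalPeriod (KZ.of G.rep) =
      toFormalPeriod (KZ.of (F.tensor G).rep) :=
    joinProd_tensor F G (F.tensor G) fun z _ => (RFun.fn_tensor F G z).symm
  have eF : toFormalPeriod (KZ.of F.rep) =
      toFormalPeriod (KZ.of B₁.rep) + toFormalPeriod (KZ.of (RFun.const γf : RFun 0).rep) := by
    rw [joinProd_split hf, joinProd_bridge hs₁f hs₁fi B₁ fun x _ => hB₁ x,
      joinProd_bridge hs₀f hs₀fi (RFun.const γf : RFun 0) fun x _ => RFun.fn_const γf x]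
  have eG : toFormalPeriod (KZ.of G.rep) =
      toFormalPeriod (KZ.of B₂.rep) + toFormalPeriod (KZ.of (RFun.const γg : RFun 0).rep) := by
    rw [joinProd_split hg, joinProd_bridge hs₁g hs₁gi B₂ fun x _ => hB₂ x,
      joinProd_bridge hs₀g hs₀gi (RFun.const γg : RFun 0) fun x _ => RFun.fn_const γg x]
  have e₁₁ := joinProd_nf1_mul_nf1 B₁ B₂ E hB₁ hB₂ hE
  have e₁₀ := joinProd_nf1_mul_nf0 B₁ (RFun.const γg : RFun 0) B₁₂ hB₁ (fun x => RFun.fn_const γg x) hB₁₂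
  have e₀₁ := joinProd_nf1_mul_nf0 B₂ (RFun.const γf : RFun 0) B₂₁ hB₂ (fun x => RFun.fn_const γf x) hB₂₁
  have e₀₀ := joinProd_nf0_mul_nf0 (RFun.const γf : RFun 0) (RFun.const γg : RFun 0)
    (RFun.const (γf * γg) : RFun 0) (fun x => RFun.fn_const γf x) (fun x => RFun.fn_const γg x)
    fun x => RFun.fn_const (γf * γg) x
  have eB := joinProd_nf1_add B₁₂ B₂₁ B hB₁₂ hB₂₁ hB
  linear_combination eR - eT + toFormalPeriod (KZ.of G.rep) * eF +
    (toFormalPeriod (KZ.of B₁.rep) + toFormalPeriod (KZ.of (RFun.const γf : RFun 0).rep)) * eG +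
    e₁₁ + e₁₀ + e₀₁ + e₀₀ - eB

end Summit.KontsevichZagierPeriods.HermiteRigidity.ReductionRigidity

end
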